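import Literature.Barriers.QuantumFields.NoClassicalGlueballsConformalCurrent
import HarnessLib

/-!
# Decay of classical Yang–Mills fields: the flux inequalities (proofs)

Sibling proof file of `Literature/Barriers/QuantumFields/NoClassicalGlueballs.lean` (barrier
catalogue D-0021, summit `QuantumFields`), towards the named fact `GlasseyStraussLocalEnergyDecay`
(Glassey–Strauss, CMP 65 (1979), §4 Theorem). In the abstract setting of
`NoClassicalGlueballsStressTensor` (any coefficient algebra `𝔸`, any invariant positive form `B`,
ANY connection `A` — no field equations are needed here) this file proves the pointwise
inequalities of Glassey–Strauss §4, p. 6 ("The integrand on the left is nonnegative and can be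
written as a sum of squares … The calculation just completed shows that `|Σ_k ω_k p_k| ≤ e`"):

* Cauchy–Schwarz for `B` (`IsInvariantForm.apply_le_norm_mul_norm`, `abs_apply_le`);
* the component form of `θ₀₀` (`two_mul_stressTensor_zero_zero`: `2θ₀₀ = |E|² + |H|²`) and of
  the Poynting term `Σ_i y_i θ_{0i} = Σ_k B(E_k, G_k)` (`sum_mul_stressTensor_zero_succ`);
* two **sum-of-squares identities** in the `B`-algebra (expanded with `Fin.sum_univ_four`, the
  antisymmetry of `F`, bilinearity and symmetry of `B`, then `ring` / `linear_combination`):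
  `|y|²θ₀₀ − Σ_{ij} y_iy_jθ_{ij} = B(E_y,E_y) + B(Z,Z)` and
  `2|y|²θ₀₀ ± 2|y| Σ_i y_iθ_{0i} = Σ_k B(W_k^±, W_k^±) + B(Z,Z)` (`Z = y₁F₂₃ − y₂F₁₃ + y₃F₁₂`, the
  Lagrange identity for `y × H`), whence
* `|Σ_i y_i θ_{0i}| ≤ |y| θ₀₀` (`abs_sum_mul_stressTensor_zero_succ_le`; Coleman (9)) and
  `Σ_{ij} y_i y_j θ_{ij} ≤ |y|² θ₀₀` (`sum_mul_mul_stressTensor_succ_succ_le`);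
* for the inversional current `J = conformalCurrent B A t₀` in the chart `(t, y)`:
  `(|t − t₀| − |y|)² θ₀₀ ≤ J⁰` (`sq_mul_stressTensor_le_conformalCurrent_zero`, the pointwise form of
  Glassey–Strauss (15) `∫ (t − r)² e ≤ const`), `0 ≤ J⁰`, and the **outgoing-flux inequality**
  `0 ≤ ⟨y⟩ J⁰ + Σ_j y_j Jʲ` for `t ≥ t₀` (`conformalCurrent_flux_nonneg`, `⟨y⟩ = √(1+|y|²)`), which
  makes the inversional charge inside the shrinking regions `⟨y⟩ + t ≤ const` non-increasing
  (the cone estimate of the next file).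

## References

* R. T. Glassey, W. A. Strauss, *Decay of classical Yang–Mills fields*, Commun. Math. Phys. 65
  (1979) 1–13, §3 (10), (11); §4, p. 6 and (15) [GlasseyStrauss1979].
* S. Coleman, *There are no classical glueballs*, Commun. Math. Phys. 55 (1977) 113–116, §2 (7), (9)
  [Coleman1977].
-/

noncomputable section

namespace Literature.Barriers.QuantumFields

open Literature.MathematicalPhysics.QuantumLattice

variable {𝔸 : Type*} [NormedRing 𝔸] [NormedAlgebra ℝ 𝔸]

/-! ### Cauchy–Schwarz for invariant positive forms -/

namespace IsInvariantForm

variable {𝔤 : Submodule ℝ 𝔸} {B : 𝔸 →L[ℝ] 𝔸 →L[ℝ] ℝ}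

/-- `0 ≤ B(X, X)`. [folklore] -/
theorem apply_self_nonneg (hB : IsInvariantForm 𝔤 B) (X : 𝔸) : 0 ≤ B X X := by
  rw [hB.apply_self]; positivity

/-- **Cauchy–Schwarz** for an invariant positive form: `B(X, Y) ≤ ‖X‖ ‖Y‖`. [folklore] -/
theorem apply_le_norm_mul_norm (hB : IsInvariantForm 𝔤 B) (X Y : 𝔸) : B X Y ≤ ‖X‖ * ‖Y‖ := by
  by_cases hX : X = 0
  · simp [hX]
  by_cases hY : Y = 0
  · simp [hY]
  have hp : 0 < ‖X‖ * ‖Y‖ := mul_pos (norm_pos_iff.2 hX) (norm_pos_iff.2 hY)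
  have h := hB.apply_self_nonneg (‖Y‖ • X - ‖X‖ • Y)
  simp only [map_sub, map_smul, sub_apply, smul_apply, smul_eq_mul] at h
  rw [hB.apply_self X, hB.apply_self Y, hB.symm Y X] at h
  nlinarith [h, hp, norm_nonneg X, norm_nonneg Y]

/-- `|B(X, Y)| ≤ ‖X‖ ‖Y‖`. [folklore] -/
theorem abs_apply_le (hB : IsInvariantForm 𝔤 B) (X Y : 𝔸) : |B X Y| ≤ ‖X‖ * ‖Y‖ := by
  refine _root_.abs_le.2 ⟨?_, hB.apply_le_norm_mul_norm X Y⟩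
  have h := hB.apply_le_norm_mul_norm (-X) Y
  rw [map_neg, neg_apply, norm_neg] at h
  linarith

end IsInvariantForm

/-! ### Values of the metric -/

/-- `η^{11} = −1`. [folklore] -/
@[simp] theorem metricDiag_one : metricDiag 1 = -1 := by simp [metricDiag]

/-- `η^{22} = −1`. [folklore] -/
@[simp] theorem metricDiag_two : metricDiag 2 = -1 := by simp [metricDiag]

/-- `η^{33} = −1`. [folklore] -/
@[simp] theorem metricDiag_three : metricDiag 3 = -1 := by simp [metricDiag]

/-! ### The three sum-of-squares identities -/

section Identities

variable {𝔤 : Submodule ℝ 𝔸} {B : 𝔸 →L[ℝ] 𝔸 →L[ℝ] ℝ} (A : Connection (SpaceTime 3) 𝔸)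
  (x : SpaceTime 3)

/-- **The energy density in components**:
`2 θ₀₀ = Σ_k B(F_{0k}, F_{0k}) + (B(F₁₂,F₁₂) + B(F₁₃,F₁₃) + B(F₂₃,F₂₃))` (`= |E|² + |H|²`).
[cite: GlasseyStrauss1979, §3 (10)] -/
theorem two_mul_stressTensor_zero_zero :
    2 * stressTensor B A 0 0 x =
      (B (fieldStrength A 0 1 x) (fieldStrength A 0 1 x) + B (fieldStrength A 0 2 x) (fieldStrength A 0 2 x) +
        B (fieldStrength A 0 3 x) (fieldStrength A 0 3 x)) +
      (B (fieldStrength A 1 2 x) (fieldStrength A 1 2 x) + B (fieldStrength A 1 3 x) (fieldStrength A 1 3 x) +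
        B (fieldStrength A 2 3 x) (fieldStrength A 2 3 x)) := by
  simp only [stressTensor, Fin.sum_univ_four, metricDiag_zero, metricDiag_one, metricDiag_two,
    metricDiag_three, fieldStrength_self, map_zero, if_true,
    fieldStrength_antisymm A 0 1 x, fieldStrength_antisymm A 0 2 x, fieldStrength_antisymm A 0 3 x,
    fieldStrength_antisymm A 1 2 x, fieldStrength_antisymm A 1 3 x, fieldStrength_antisymm A 2 3 x,
    map_neg, neg_apply, neg_neg]
  ring

/-- `(2 : Fin 3).succ = 3`. [folklore] -/
theorem fin_succ_two_eq_three : (2 : Fin 3).succ = (3 : Fin 4) := rfl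

/-- **The Poynting term in components**: `P(y) = Σ_i y_i θ_{0i} = Σ_k B(F_{0k}, G_k)` with
`G₁ = −(y₂F₁₂ + y₃F₁₃)`, `G₂ = y₁F₁₂ − y₃F₂₃`, `G₃ = y₁F₁₃ + y₂F₂₃` (`θ_{0i} = Σ_k B(F_{0k}, F_{ik})`;
Glassey–Strauss (11)). [cite: GlasseyStrauss1979, §3 (11)] -/
theorem sum_mul_stressTensor_zero_succ (y : EuclideanSpace ℝ (Fin 3)) :
    ∑ i : Fin 3, y i * stressTensor B A 0 i.succ x =
      B (fieldStrength A 0 1 x) (-(y 1 • fieldStrength A 1 2 x + y 2 • fieldStrength A 1 3 x)) +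
        B (fieldStrength A 0 2 x) (y 0 • fieldStrength A 1 2 x - y 2 • fieldStrength A 2 3 x) +
        B (fieldStrength A 0 3 x) (y 0 • fieldStrength A 1 3 x + y 1 • fieldStrength A 2 3 x) := by
  simp only [Fin.sum_univ_three, Fin.succ_zero_eq_one, Fin.succ_one_eq_two, fin_succ_two_eq_three,
    stressTensor, Fin.sum_univ_four, metricDiag_zero, metricDiag_one, metricDiag_two,
    metricDiag_three, fieldStrength_self, map_zero, zero_apply, Fin.reduceEq, if_false,
    fieldStrength_antisymm A 0 1 x, fieldStrength_antisymm A 0 2 x, fieldStrength_antisymm A 0 3 x,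
    fieldStrength_antisymm A 1 2 x, fieldStrength_antisymm A 1 3 x, fieldStrength_antisymm A 2 3 x,
    map_neg, neg_apply, neg_neg, map_add, map_sub, map_smul, smul_eq_mul]
  ring

variable {A x}

/-- **Second sum-of-squares identity** (behind `|θ_{ij} yⁱ yʲ| ≤ |y|² θ₀₀`):
`|y|² θ₀₀ − Σ_{ij} y_i y_j θ_{ij} = B(E_y, E_y) + B(Z, Z)` with `E_y = Σ_i y_i F_{0i}` and
`Z = y₁F₂₃ − y₂F₁₃ + y₃F₁₂` (the Lagrange identity for `y × H`). [cite: GlasseyStrauss1979, §4 (p. 6)] -/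
theorem norm_sq_mul_stressTensor_zero_zero_sub_sum (hB : IsInvariantForm 𝔤 B)
    (y : EuclideanSpace ℝ (Fin 3)) :
    ‖y‖ ^ 2 * stressTensor B A 0 0 x -
        ∑ i : Fin 3, ∑ j : Fin 3, y i * y j * stressTensor B A i.succ j.succ x =
      B (y 0 • fieldStrength A 0 1 x + y 1 • fieldStrength A 0 2 x + y 2 • fieldStrength A 0 3 x)
          (y 0 • fieldStrength A 0 1 x + y 1 • fieldStrength A 0 2 x + y 2 • fieldStrength A 0 3 x) +
        B (y 0 • fieldStrength A 2 3 x - y 1 • fieldStrength A 1 3 x + y 2 • fieldStrength A 1 2 x)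
          (y 0 • fieldStrength A 2 3 x - y 1 • fieldStrength A 1 3 x + y 2 • fieldStrength A 1 2 x) := by
  rw [EuclideanSpace.real_norm_sq_eq]
  simp only [Fin.sum_univ_three, Fin.succ_zero_eq_one, Fin.succ_one_eq_two, fin_succ_two_eq_three,
    stressTensor, Fin.sum_univ_four, metricDiag_zero, metricDiag_one, metricDiag_two,
    metricDiag_three, fieldStrength_self, map_zero, zero_apply, Fin.reduceEq, if_false, if_true,
    fieldStrength_antisymm A 0 1 x, fieldStrength_antisymm A 0 2 x, fieldStrength_antisymm A 0 3 x,
    fieldStrength_antisymm A 1 2 x, fieldStrength_antisymm A 1 3 x, fieldStrength_antisymm A 2 3 x,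
    map_neg, neg_apply, neg_neg, map_add, map_sub, map_smul, add_apply, sub_apply, smul_apply,
    smul_eq_mul, mul_zero, zero_mul, mul_one, mul_neg, neg_mul, one_mul]
  simp only [hB.symm (fieldStrength A 0 2 x) (fieldStrength A 0 1 x),
    hB.symm (fieldStrength A 0 3 x) (fieldStrength A 0 1 x),
    hB.symm (fieldStrength A 0 3 x) (fieldStrength A 0 2 x),
    hB.symm (fieldStrength A 1 3 x) (fieldStrength A 1 2 x),
    hB.symm (fieldStrength A 2 3 x) (fieldStrength A 1 2 x),
    hB.symm (fieldStrength A 2 3 x) (fieldStrength A 1 3 x)]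
  ring

/-- **First sum-of-squares identity** (behind `|Σ_i y_i θ_{0i}| ≤ |y| θ₀₀`, Glassey–Strauss'
`|Σ_k ω_k p_k| ≤ e`): for `σ = ±1`,
`2|y|² θ₀₀ + 2σ|y| Σ_i y_i θ_{0i} = Σ_k B(|y| F_{0k} + σG_k, |y| F_{0k} + σG_k) + B(Z, Z)`
(`G_k`, `Z` as above). [cite: GlasseyStrauss1979, §4 (p. 6)] -/
theorem two_mul_norm_sq_mul_stressTensor_zero_zero_add (hB : IsInvariantForm 𝔤 B)
    (y : EuclideanSpace ℝ (Fin 3)) {σ : ℝ} (hσ : σ ^ 2 = 1) :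
    2 * ‖y‖ ^ 2 * stressTensor B A 0 0 x + 2 * σ * ‖y‖ * ∑ i : Fin 3, y i * stressTensor B A 0 i.succ x =
      B (‖y‖ • fieldStrength A 0 1 x + σ • -(y 1 • fieldStrength A 1 2 x + y 2 • fieldStrength A 1 3 x))
          (‖y‖ • fieldStrength A 0 1 x + σ • -(y 1 • fieldStrength A 1 2 x + y 2 • fieldStrength A 1 3 x)) +
        B (‖y‖ • fieldStrength A 0 2 x + σ • (y 0 • fieldStrength A 1 2 x - y 2 • fieldStrength A 2 3 x))
          (‖y‖ • fieldStrength A 0 2 x + σ • (y 0 • fieldStrength A 1 2 x - y 2 • fieldStrength A 2 3 x)) +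
        B (‖y‖ • fieldStrength A 0 3 x + σ • (y 0 • fieldStrength A 1 3 x + y 1 • fieldStrength A 2 3 x))
          (‖y‖ • fieldStrength A 0 3 x + σ • (y 0 • fieldStrength A 1 3 x + y 1 • fieldStrength A 2 3 x)) +
        B (y 0 • fieldStrength A 2 3 x - y 1 • fieldStrength A 1 3 x + y 2 • fieldStrength A 1 2 x)
          (y 0 • fieldStrength A 2 3 x - y 1 • fieldStrength A 1 3 x + y 2 • fieldStrength A 1 2 x) := by
  have hr : ‖y‖ ^ 2 = y 0 ^ 2 + y 1 ^ 2 + y 2 ^ 2 := by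
    rw [EuclideanSpace.real_norm_sq_eq, Fin.sum_univ_three]
  have h0 := two_mul_stressTensor_zero_zero (B := B) A x
  have e : 2 * ‖y‖ ^ 2 * stressTensor B A 0 0 x = ‖y‖ ^ 2 * (2 * stressTensor B A 0 0 x) := by ring
  rw [e, h0, sum_mul_stressTensor_zero_succ A x y]
  simp only [map_neg, neg_apply, map_add, map_sub, map_smul, add_apply, sub_apply, smul_apply,
    smul_eq_mul]
  simp only [hB.symm (fieldStrength A 1 2 x) (fieldStrength A 0 1 x),
    hB.symm (fieldStrength A 1 2 x) (fieldStrength A 0 2 x),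
    hB.symm (fieldStrength A 1 3 x) (fieldStrength A 0 1 x),
    hB.symm (fieldStrength A 1 3 x) (fieldStrength A 0 3 x),
    hB.symm (fieldStrength A 1 3 x) (fieldStrength A 1 2 x),
    hB.symm (fieldStrength A 2 3 x) (fieldStrength A 0 2 x),
    hB.symm (fieldStrength A 2 3 x) (fieldStrength A 0 3 x),
    hB.symm (fieldStrength A 2 3 x) (fieldStrength A 1 2 x),
    hB.symm (fieldStrength A 2 3 x) (fieldStrength A 1 3 x)]
  linear_combination (B (fieldStrength A 1 2 x) (fieldStrength A 1 2 x) +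
    B (fieldStrength A 1 3 x) (fieldStrength A 1 3 x) + B (fieldStrength A 2 3 x) (fieldStrength A 2 3 x)) * hr
    - (B (fieldStrength A 1 2 x) (fieldStrength A 1 2 x) * (y 1 ^ 2 + y 0 ^ 2) +
        B (fieldStrength A 1 3 x) (fieldStrength A 1 3 x) * (y 2 ^ 2 + y 0 ^ 2) +
        B (fieldStrength A 2 3 x) (fieldStrength A 2 3 x) * (y 1 ^ 2 + y 2 ^ 2) +
        2 * y 1 * y 2 * B (fieldStrength A 1 2 x) (fieldStrength A 1 3 x) +
        2 * y 1 * y 0 * B (fieldStrength A 1 3 x) (fieldStrength A 2 3 x) -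
        2 * y 2 * y 0 * B (fieldStrength A 1 2 x) (fieldStrength A 2 3 x)) * hσ

end Identities

/-! ### The flux inequalities -/

section Inequalities

variable {𝔤 : Submodule ℝ 𝔸} {B : 𝔸 →L[ℝ] 𝔸 →L[ℝ] ℝ}

/-- `θ₀₀ ≥ 0`. [cite: Coleman1977, §2 (7)] -/
theorem stressTensor_zero_zero_nonneg (hB : IsInvariantForm 𝔤 B) (A : Connection (SpaceTime 3) 𝔸)
    (x : SpaceTime 3) : 0 ≤ stressTensor B A 0 0 x := by
  rw [stressTensor_zero_zero hB]
  exact ymEnergyDensity_nonneg A x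

/-- **`Σ_{ij} y_i y_j θ_{ij} ≤ |y|² θ₀₀`** (the normal–normal stress is at most the energy density).
[cite: GlasseyStrauss1979, §4 (p. 6)] -/
theorem sum_mul_mul_stressTensor_succ_succ_le (hB : IsInvariantForm 𝔤 B)
    (A : Connection (SpaceTime 3) 𝔸) (x : SpaceTime 3) (y : EuclideanSpace ℝ (Fin 3)) :
    ∑ i : Fin 3, ∑ j : Fin 3, y i * y j * stressTensor B A i.succ j.succ x ≤
      ‖y‖ ^ 2 * stressTensor B A 0 0 x := by
  have h := norm_sq_mul_stressTensor_zero_zero_sub_sum (A := A) (x := x) hB y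
  have h1 := hB.apply_self_nonneg
    (y 0 • fieldStrength A 0 1 x + y 1 • fieldStrength A 0 2 x + y 2 • fieldStrength A 0 3 x)
  have h2 := hB.apply_self_nonneg
    (y 0 • fieldStrength A 2 3 x - y 1 • fieldStrength A 1 3 x + y 2 • fieldStrength A 1 2 x)
  linarith

/-- **`|Σ_i y_i θ_{0i}| ≤ |y| θ₀₀`** — Glassey–Strauss' `|Σ_k ω_k p_k| ≤ e` for `|ω| = 1`, Coleman's
(9) `|eⁱ θ_{0i}| ≤ θ₀₀`: the energy flux is dominated by the energy density (propagation speed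
at most `1`). [cite: GlasseyStrauss1979, §4 (p. 6)] -/
theorem abs_sum_mul_stressTensor_zero_succ_le (hB : IsInvariantForm 𝔤 B)
    (A : Connection (SpaceTime 3) 𝔸) (x : SpaceTime 3) (y : EuclideanSpace ℝ (Fin 3)) :
    |∑ i : Fin 3, y i * stressTensor B A 0 i.succ x| ≤ ‖y‖ * stressTensor B A 0 0 x := by
  have hθ := stressTensor_zero_zero_nonneg hB A x
  have key : ∀ σ : ℝ, σ ^ 2 = 1 →
      0 ≤ 2 * ‖y‖ ^ 2 * stressTensor B A 0 0 x +
        2 * σ * ‖y‖ * ∑ i : Fin 3, y i * stressTensor B A 0 i.succ x := by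
    intro σ hσ
    rw [two_mul_norm_sq_mul_stressTensor_zero_zero_add (A := A) (x := x) hB y hσ]
    have h1 := hB.apply_self_nonneg
      (‖y‖ • fieldStrength A 0 1 x + σ • -(y 1 • fieldStrength A 1 2 x + y 2 • fieldStrength A 1 3 x))
    have h2 := hB.apply_self_nonneg
      (‖y‖ • fieldStrength A 0 2 x + σ • (y 0 • fieldStrength A 1 2 x - y 2 • fieldStrength A 2 3 x))
    have h3 := hB.apply_self_nonneg
      (‖y‖ • fieldStrength A 0 3 x + σ • (y 0 • fieldStrength A 1 3 x + y 1 • fieldStrength A 2 3 x))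
    have h4 := hB.apply_self_nonneg
      (y 0 • fieldStrength A 2 3 x - y 1 • fieldStrength A 1 3 x + y 2 • fieldStrength A 1 2 x)
    linarith
  by_cases hy : y = 0
  · subst hy
    simp
  have hr : 0 < ‖y‖ := norm_pos_iff.2 hy
  have k1 := key 1 (by norm_num)
  have k2 := key (-1) (by norm_num)
  rw [abs_le]
  constructor <;> nlinarith [k1, k2, hr]

/-- `|y| ≤ ⟨y⟩ = √(1 + |y|²)`. [folklore] -/
theorem norm_le_sqrt_one_add_norm_sq (y : EuclideanSpace ℝ (Fin 3)) : ‖y‖ ≤ √(1 + ‖y‖ ^ 2) :=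
  calc ‖y‖ = √(‖y‖ ^ 2) := (Real.sqrt_sq (norm_nonneg _)).symm
    _ ≤ √(1 + ‖y‖ ^ 2) := Real.sqrt_le_sqrt (by linarith)

/-- **Lower bound for the inversional density**: in the chart `(t, y)`,
`(|t − t₀| − |y|)² θ₀₀ ≤ J⁰ = ((t−t₀)² + |y|²) θ₀₀ + 2(t−t₀) Σ_i y_i θ_{0i}` — Glassey–Strauss'
step from the inversional charge to (15), `∫ (t − r)² e dx ≤ const`. [cite: GlasseyStrauss1979, §4 (15)] -/
theorem sq_mul_stressTensor_le_conformalCurrent_zero (hB : IsInvariantForm 𝔤 B)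
    (A : Connection (SpaceTime 3) 𝔸) (t₀ t : ℝ) (y : EuclideanSpace ℝ (Fin 3)) :
    (|t - t₀| - ‖y‖) ^ 2 * stressTensor B A 0 0 (ofTimeSpace t y) ≤
      conformalCurrent B A t₀ 0 (ofTimeSpace t y) := by
  rw [conformalCurrent_zero_ofTimeSpace]
  set P := ∑ i : Fin 3, y i * stressTensor B A 0 i.succ (ofTimeSpace t y)
  set θ := stressTensor B A 0 0 (ofTimeSpace t y)
  have hP : |P| ≤ ‖y‖ * θ := abs_sum_mul_stressTensor_zero_succ_le hB A _ y
  have hθ : 0 ≤ θ := stressTensor_zero_zero_nonneg hB A _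
  have h1 : |(t - t₀) * P| ≤ |t - t₀| * (‖y‖ * θ) := by
    rw [abs_mul]
    exact mul_le_mul_of_nonneg_left hP (abs_nonneg _)
  have h2 := neg_abs_le ((t - t₀) * P)
  have h3 : |t - t₀| ^ 2 = (t - t₀) ^ 2 := sq_abs _
  nlinarith [h1, h2, h3, abs_nonneg (t - t₀), norm_nonneg y]

/-- The inversional density is nonnegative: `0 ≤ J⁰(t, y)`. [cite: GlasseyStrauss1979, §4 (15)] -/
theorem conformalCurrent_zero_ofTimeSpace_nonneg (hB : IsInvariantForm 𝔤 B)
    (A : Connection (SpaceTime 3) 𝔸) (t₀ t : ℝ) (y : EuclideanSpace ℝ (Fin 3)) :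
    0 ≤ conformalCurrent B A t₀ 0 (ofTimeSpace t y) :=
  (mul_nonneg (sq_nonneg _) (stressTensor_zero_zero_nonneg hB A _)).trans
    (sq_mul_stressTensor_le_conformalCurrent_zero hB A t₀ t y)

/-- `0 ≤ J⁰(x)` at every space-time point. [cite: GlasseyStrauss1979, §4 (15)] -/
theorem conformalCurrent_zero_nonneg (hB : IsInvariantForm 𝔤 B) (A : Connection (SpaceTime 3) 𝔸)
    (t₀ : ℝ) (x : SpaceTime 3) : 0 ≤ conformalCurrent B A t₀ 0 x := by
  rw [← ofTimeSpace_apply_zero_spaceC x]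
  exact conformalCurrent_zero_ofTimeSpace_nonneg hB A t₀ _ _

/-- **The flux of the inversional current through the cones `⟨y⟩ + t = const` is outgoing**:
for `t ≥ t₀`, `0 ≤ ⟨y⟩ J⁰(t, y) + Σ_j y_j Jʲ(t, y)` (`⟨y⟩ = √(1 + |y|²)`). With `τ = t − t₀`,
`r = |y|`, `P = Σ y_iθ_{0i}`, `S = Σ y_iy_jθ_{ij}`: `⟨y⟩J⁰ − K⁰P − 2τS ≥ r J⁰ − K⁰P − 2τ r² θ₀₀ =
(τ − r)² (r θ₀₀ − P) ≥ 0` by `|P| ≤ r θ₀₀`, `S ≤ r² θ₀₀`, `J⁰ ≥ 0`. This is the (integrated form of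
the) dominant energy condition used by Glassey–Strauss on p. 6 ("the integrand … is nonnegative
and can be written as a sum of squares"). [cite: GlasseyStrauss1979, §4 (p. 6)] -/
theorem conformalCurrent_flux_nonneg (hB : IsInvariantForm 𝔤 B) (A : Connection (SpaceTime 3) 𝔸)
    {t₀ t : ℝ} (ht : t₀ ≤ t) (y : EuclideanSpace ℝ (Fin 3)) :
    0 ≤ √(1 + ‖y‖ ^ 2) * conformalCurrent B A t₀ 0 (ofTimeSpace t y) +
      ∑ j : Fin 3, y j * conformalCurrent B A t₀ j.succ (ofTimeSpace t y) := by
  have hJ := conformalCurrent_zero_ofTimeSpace_nonneg hB A t₀ t y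
  rw [conformalCurrent_zero_ofTimeSpace] at hJ ⊢
  simp only [conformalCurrent_succ_ofTimeSpace]
  set θ := stressTensor B A 0 0 (ofTimeSpace t y) with hθdef
  set P := ∑ i : Fin 3, y i * stressTensor B A 0 i.succ (ofTimeSpace t y) with hPdef
  set S := ∑ i : Fin 3, ∑ j : Fin 3, y i * y j * stressTensor B A i.succ j.succ (ofTimeSpace t y)
    with hSdef
  have hsym : ∀ j : Fin 3, stressTensor B A j.succ 0 (ofTimeSpace t y) =
      stressTensor B A 0 j.succ (ofTimeSpace t y) := fun j => stressTensor_symm hB A _ _ _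
  have e1 : ∑ j : Fin 3, y j * -(((t - t₀) ^ 2 + ‖y‖ ^ 2) * stressTensor B A j.succ 0 (ofTimeSpace t y) +
      2 * (t - t₀) * ∑ i : Fin 3, y i * stressTensor B A j.succ i.succ (ofTimeSpace t y)) =
      -(((t - t₀) ^ 2 + ‖y‖ ^ 2) * P) - 2 * (t - t₀) * S := by
    have hS' : S = ∑ j : Fin 3, ∑ i : Fin 3,
        y j * y i * stressTensor B A j.succ i.succ (ofTimeSpace t y) := hSdef
    rw [hS', hPdef, Finset.mul_sum, Finset.mul_sum, ← Finset.sum_neg_distrib,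
      ← Finset.sum_sub_distrib]
    refine Finset.sum_congr rfl fun j _ => ?_
    rw [hsym j, Finset.mul_sum, Finset.mul_sum, neg_add, mul_add, mul_neg, mul_neg, Finset.mul_sum,
      ← sub_eq_add_neg]
    congr 1
    · ring
    · exact Finset.sum_congr rfl fun i _ => by ring
  rw [e1]
  -- the ingredients
  have hθ : 0 ≤ θ := stressTensor_zero_zero_nonneg hB A _
  have hP : |P| ≤ ‖y‖ * θ := abs_sum_mul_stressTensor_zero_succ_le hB A _ y
  have hS : S ≤ ‖y‖ ^ 2 * θ := sum_mul_mul_stressTensor_succ_succ_le hB A _ y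
  have hyr : ‖y‖ ≤ √(1 + ‖y‖ ^ 2) := norm_le_sqrt_one_add_norm_sq y
  have hτ : 0 ≤ t - t₀ := sub_nonneg.2 ht
  have hPle : P ≤ ‖y‖ * θ := (le_abs_self P).trans hP
  -- the chain of inequalities
  have i1 : ‖y‖ * (((t - t₀) ^ 2 + ‖y‖ ^ 2) * θ + 2 * (t - t₀) * P) ≤
      √(1 + ‖y‖ ^ 2) * (((t - t₀) ^ 2 + ‖y‖ ^ 2) * θ + 2 * (t - t₀) * P) :=
    mul_le_mul_of_nonneg_right hyr hJ
  have i2 : 2 * (t - t₀) * S ≤ 2 * (t - t₀) * (‖y‖ ^ 2 * θ) :=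
    mul_le_mul_of_nonneg_left hS (by positivity)
  have i3 : 0 ≤ (t - t₀ - ‖y‖) ^ 2 * (‖y‖ * θ - P) := mul_nonneg (sq_nonneg _) (by linarith)
  have e2 : ‖y‖ * (((t - t₀) ^ 2 + ‖y‖ ^ 2) * θ + 2 * (t - t₀) * P) -
      ((t - t₀) ^ 2 + ‖y‖ ^ 2) * P - 2 * (t - t₀) * (‖y‖ ^ 2 * θ) =
      (t - t₀ - ‖y‖) ^ 2 * (‖y‖ * θ - P) := by ring
  nlinarith [i1, i2, i3, e2]

end Inequalities

end Literature.Barriers.QuantumFields
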